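import Summits.Ventures.DiscreteObjects.Hadamard.ConferenceGraph333SylowBounds
import Summits.Ventures.DiscreteObjects.Hadamard.ConferenceGraph333CycleParity

/-!
# Census of Aut(srg(333,166,82,83)), gen 29: excluded orders `49, 69, 99, 121, 125, 169`; group level `13² ∤ |G|`, prime divisors

Framing: lottery ticket; floor = certified bounds/negative ranges.  Cell pub-namedobj (venture DiscreteObjects),
target (H) = `H(668)`, hadamard gen 29.  Applications of the omega-ready census kit `aut_cycle_length_census`
(`ConferenceGraph333CycleParity`: cycle-type parity + fixed points of powers + the orbit bound) together with the prime windows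
(`ConferenceGraph333PrimeSpectrum`, `…OddFixedPoints`) and the group-level file `ConferenceGraph333SylowBounds`:
* **`no_aut_order_121`**, **`no_aut_order_125`**, **`no_aut_order_99`**, **`no_aut_order_169`**, **`no_aut_order_49`**,
  **`no_aut_order_69`** — no automorphism of these orders (`49`: a `49`-orbit forces `f ≤ 5` while `σ⁷` fixes `39`
  points in `7`- and `1`-orbits of `σ`, parity; `69`: a `69`-orbit forces `f ≤ 3`, otherwise `σ^23` fixes `> 81` points);
* **`autGroup_prime_dvd_card_refined`** — the prime divisors of `|G|` lie in **`{2,3,5,7,11,13,23,37,41,83}`** (no `17`);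
* **`autGroup_card_not_dvd_13_sq`** — **`13² ∤ |G|`** (a subgroup of order `169` has `168` elements of order `13` with `21` fixed
  points each; Burnside `333 + 168·21 = 3861 ≢ 0 (mod 169)`; Mathlib `MulAction.sum_card_fixedBy_eq_card_orbits_mul_card_group`);
* **`autGroup_order_shape`** — summary: every prime `p ∣ |G|` is in the list and `p² ∤ |G|` for `p ∈ {13,23,37,41,83}`:
  `|Aut(srg(333,166,82,83))|` divides `2^a·3^b·5^c·7^d·11^e·13·23·37·41·83`.
Script (code/order_census_g29.py, exact, all kernel laws): the element orders lie in a 71-element list with maximum `166`.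
Structure of a HYPOTHETICAL object; ours (PROVISIONAL).  No `sorry`, no new definitions.
-/

namespace Summit.Ventures.DiscreteObjects.Hadamard

open Finset MulAction

section orders
variable {V : Type*} [Fintype V] [DecidableEq V]

/-! ## §1 Excluded element orders -/

/-- **No automorphism of order `121`**: `σ^11` (order `11`) fixes `3` or `25` points, the other `330` or `308` points lie in
`121`-orbits — impossible. -/
theorem no_aut_order_121 (hV : Fintype.card V = 333) (A : Matrix V V ℤ)
    (h01 : ∀ x y, A x y = 0 ∨ A x y = 1) (hsymm : ∀ x y, A y x = A x y) (hdiag : ∀ x, A x x = 0)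
    (hk : ∀ x, ∑ y, A x y = 166) (hsrg : ∀ x y, ∑ z, A x z * A z y = 83 * (1 + (if x = y then 1 else 0)) - A x y)
    (σ : Equiv.Perm V) (hσ : σ ^ 121 = 1) (hσ11 : σ ^ 11 ≠ 1) (hA : ∀ x y, A (σ x) (σ y) = A x y) : False := by
  have hAk := adj_pow_invariant A σ hA
  obtain ⟨c, h1, h2, h3, -, -⟩ := aut_cycle_length_census hV A h01 hsymm hdiag hk hsrg σ hσ (by norm_num) hA
  have hD : Nat.divisors 121 = {1, 11, 121} := by decide
  have f11 := h2 11
  have d121 := h3 121 (by norm_num)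
  simp only [hD, Finset.sum_filter] at h1 f11 d121
  norm_num at h1 f11 d121
  have hp11 : (σ ^ 11) ^ 11 = 1 := by rw [← pow_mul]; exact hσ
  obtain ⟨-, -, -, h11w, -⟩ :=
    aut_prime_windows hV A h01 hsymm hdiag hk hsrg (by norm_num : Nat.Prime 11) (by norm_num) (σ ^ 11) hp11 hσ11 (hAk 11)
  have hw := h11w rfl
  rw [f11] at hw
  omega

/-- **No automorphism of order `125`**: `σ^25` (order `5`) fixes at most `53` points, the rest lies in `125`-orbits. -/
theorem no_aut_order_125 (hV : Fintype.card V = 333) (A : Matrix V V ℤ)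
    (h01 : ∀ x y, A x y = 0 ∨ A x y = 1) (hsymm : ∀ x y, A y x = A x y) (hdiag : ∀ x, A x x = 0)
    (hk : ∀ x, ∑ y, A x y = 166) (hsrg : ∀ x y, ∑ z, A x z * A z y = 83 * (1 + (if x = y then 1 else 0)) - A x y)
    (σ : Equiv.Perm V) (hσ : σ ^ 125 = 1) (hσ25 : σ ^ 25 ≠ 1) (hA : ∀ x y, A (σ x) (σ y) = A x y) : False := by
  have hAk := adj_pow_invariant A σ hA
  obtain ⟨c, h1, h2, h3, -, -⟩ := aut_cycle_length_census hV A h01 hsymm hdiag hk hsrg σ hσ (by norm_num) hA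
  have hD : Nat.divisors 125 = {1, 5, 25, 125} := by decide
  have f25 := h2 25
  have d125 := h3 125 (by norm_num)
  simp only [hD, Finset.sum_filter] at h1 f25 d125
  norm_num at h1 f25 d125
  have hp5 : (σ ^ 25) ^ 5 = 1 := by rw [← pow_mul]; exact hσ
  obtain ⟨-, h5w, -⟩ :=
    aut_prime_windows hV A h01 hsymm hdiag hk hsrg (by norm_num : Nat.Prime 5) (by norm_num) (σ ^ 25) hp5 hσ25 (hAk 25)
  have hw := h5w rfl
  rw [f25] at hw
  omega

/-- **No automorphism of order `99 = 9·11`** (needs the parity law: the `99`-orbits would be `3` in number). -/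
theorem no_aut_order_99 (hV : Fintype.card V = 333) (A : Matrix V V ℤ)
    (h01 : ∀ x y, A x y = 0 ∨ A x y = 1) (hsymm : ∀ x y, A y x = A x y) (hdiag : ∀ x, A x x = 0)
    (hk : ∀ x, ∑ y, A x y = 166) (hsrg : ∀ x y, ∑ z, A x z * A z y = 83 * (1 + (if x = y then 1 else 0)) - A x y)
    (σ : Equiv.Perm V) (hσ : σ ^ 99 = 1) (hσ9 : σ ^ 9 ≠ 1) (hσ33 : σ ^ 33 ≠ 1) (hA : ∀ x y, A (σ x) (σ y) = A x y) :
    False := by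
  have hAk := adj_pow_invariant A σ hA
  obtain ⟨c, h1, h2, h3, -, -⟩ := aut_cycle_length_census hV A h01 hsymm hdiag hk hsrg σ hσ (by norm_num) hA
  have hD : Nat.divisors 99 = {1, 3, 9, 11, 33, 99} := by decide
  have f9 := h2 9
  have f33 := h2 33
  have d3 := h3 3 (by norm_num)
  have d9 := h3 9 (by norm_num)
  have d11 := h3 11 (by norm_num)
  have d33 := h3 33 (by norm_num)
  have d99 := h3 99 (by norm_num)
  simp only [hD, Finset.sum_filter] at h1 f9 f33 d3 d9 d11 d33 d99
  norm_num at h1 f9 f33 d3 d9 d11 d33 d99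
  have hp11 : (σ ^ 9) ^ 11 = 1 := by rw [← pow_mul]; exact hσ
  have hp3 : (σ ^ 33) ^ 3 = 1 := by rw [← pow_mul]; exact hσ
  obtain ⟨-, -, -, h11w, -⟩ :=
    aut_prime_windows hV A h01 hsymm hdiag hk hsrg (by norm_num : Nat.Prime 11) (by norm_num) (σ ^ 9) hp11 hσ9 (hAk 9)
  obtain ⟨h3w, -⟩ :=
    aut_prime_windows hV A h01 hsymm hdiag hk hsrg (by norm_num : Nat.Prime 3) (by norm_num) (σ ^ 33) hp3 hσ33 (hAk 33)
  have hw11 := h11w rfl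
  have hw3 := h3w rfl
  rw [f9] at hw11; rw [f33] at hw3
  omega


/-- **No automorphism of order `49`.** -/
theorem no_aut_order_49 (hV : Fintype.card V = 333) (A : Matrix V V ℤ)
    (h01 : ∀ x y, A x y = 0 ∨ A x y = 1) (hsymm : ∀ x y, A y x = A x y) (hdiag : ∀ x, A x x = 0)
    (hk : ∀ x, ∑ y, A x y = 166) (hsrg : ∀ x y, ∑ z, A x z * A z y = 83 * (1 + (if x = y then 1 else 0)) - A x y)
    (σ : Equiv.Perm V) (hσ : σ ^ 49 = 1) (hσ7 : σ ^ 7 ≠ 1) (hA : ∀ x y, A (σ x) (σ y) = A x y) : False := by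
  have hAk := adj_pow_invariant A σ hA
  obtain ⟨c, h1, h2, h3, h4, -⟩ := aut_cycle_length_census hV A h01 hsymm hdiag hk hsrg σ hσ (by norm_num) hA
  have hD : Nat.divisors 49 = {1, 7, 49} := by decide
  have f1 := h2 1
  have f7 := h2 7
  have d7 := h3 7 (by norm_num)
  have d49 := h3 49 (by norm_num)
  have o49 := h4 49 (by norm_num)
  rw [pow_one] at f1
  simp only [hD, Finset.sum_filter] at h1 f1 f7 d7 d49
  norm_num at h1 f1 f7 d7 d49
  have hp : (σ ^ 7) ^ 7 = 1 := by rw [← pow_mul]; exact hσ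
  obtain ⟨-, -, h7w, -⟩ :=
    aut_prime_windows hV A h01 hsymm hdiag hk hsrg (by norm_num : Nat.Prime 7) (by norm_num) (σ ^ 7) hp hσ7 (hAk 7)
  have hw := h7w rfl
  rw [f7] at hw
  rw [f1] at o49
  omega

/-- **No automorphism of order `69 = 3·23`.** -/
theorem no_aut_order_69 (hV : Fintype.card V = 333) (A : Matrix V V ℤ)
    (h01 : ∀ x y, A x y = 0 ∨ A x y = 1) (hsymm : ∀ x y, A y x = A x y) (hdiag : ∀ x, A x x = 0)
    (hk : ∀ x, ∑ y, A x y = 166) (hsrg : ∀ x y, ∑ z, A x z * A z y = 83 * (1 + (if x = y then 1 else 0)) - A x y)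
    (σ : Equiv.Perm V) (hσ : σ ^ 69 = 1) (hσ3 : σ ^ 3 ≠ 1) (hσ23 : σ ^ 23 ≠ 1) (hA : ∀ x y, A (σ x) (σ y) = A x y) :
    False := by
  have hAk := adj_pow_invariant A σ hA
  obtain ⟨c, h1, h2, h3, h4, -⟩ := aut_cycle_length_census hV A h01 hsymm hdiag hk hsrg σ hσ (by norm_num) hA
  have hD : Nat.divisors 69 = {1, 3, 23, 69} := by decide
  have f1 := h2 1
  have f3 := h2 3
  have f23 := h2 23
  have d3 := h3 3 (by norm_num)
  have d23 := h3 23 (by norm_num)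
  have d69 := h3 69 (by norm_num)
  have o69 := h4 69 (by norm_num)
  rw [pow_one] at f1
  simp only [hD, Finset.sum_filter] at h1 f1 f3 f23 d3 d23 d69
  norm_num at h1 f1 f3 f23 d3 d23 d69
  have hp23 : (σ ^ 3) ^ 23 = 1 := by rw [← pow_mul]; exact hσ
  have hp3 : (σ ^ 23) ^ 3 = 1 := by rw [← pow_mul]; exact hσ
  obtain ⟨-, -, -, -, -, -, h23w, -⟩ :=
    aut_prime_windows hV A h01 hsymm hdiag hk hsrg (by norm_num : Nat.Prime 23) (by norm_num) (σ ^ 3) hp23 hσ3 (hAk 3)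
  obtain ⟨h3w, -⟩ :=
    aut_prime_windows hV A h01 hsymm hdiag hk hsrg (by norm_num : Nat.Prime 3) (by norm_num) (σ ^ 23) hp3 hσ23 (hAk 23)
  have hw23 := h23w rfl
  have hw3 := h3w rfl
  rw [f3] at hw23; rw [f23] at hw3
  rw [f1] at o69
  omega

/-! ## §2 Group level -/

/-- **No automorphism of order `169 = 13²`.** -/
theorem no_aut_order_169 (hV : Fintype.card V = 333) (A : Matrix V V ℤ)
    (h01 : ∀ x y, A x y = 0 ∨ A x y = 1) (hsymm : ∀ x y, A y x = A x y) (hdiag : ∀ x, A x x = 0)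
    (hk : ∀ x, ∑ y, A x y = 166) (hsrg : ∀ x y, ∑ z, A x z * A z y = 83 * (1 + (if x = y then 1 else 0)) - A x y)
    (σ : Equiv.Perm V) (hσ : σ ^ 169 = 1) (hσ13 : σ ^ 13 ≠ 1) (hA : ∀ x y, A (σ x) (σ y) = A x y) : False := by
  have hAk := adj_pow_invariant A σ hA
  obtain ⟨c, h1, h2, h3, -, -⟩ := aut_cycle_length_census hV A h01 hsymm hdiag hk hsrg σ hσ (by norm_num) hA
  have hD : Nat.divisors 169 = {1, 13, 169} := by decide
  have f13 := h2 13
  have d169 := h3 169 (by norm_num)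
  simp only [hD, Finset.sum_filter] at h1 f13 d169
  norm_num at h1 f13 d169
  have hp : (σ ^ 13) ^ 13 = 1 := by rw [← pow_mul]; exact hσ
  have hw := aut_order13_fixed hV A h01 hsymm hdiag hk hsrg (σ ^ 13) hp hσ13 (hAk 13)
  rw [f13] at hw
  omega

/-- **Prime divisors of `|G|`, refined**: in `{2, 3, 5, 7, 11, 13, 23, 37, 41, 83}` (no `17`). -/
theorem autGroup_prime_dvd_card_refined (hV : Fintype.card V = 333) (A : Matrix V V ℤ)
    (h01 : ∀ x y, A x y = 0 ∨ A x y = 1) (hsymm : ∀ x y, A y x = A x y) (hdiag : ∀ x, A x x = 0)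
    (hk : ∀ x, ∑ y, A x y = 166) (hsrg : ∀ x y, ∑ z, A x z * A z y = 83 * (1 + (if x = y then 1 else 0)) - A x y)
    (G : Subgroup (Equiv.Perm V)) (hG : ∀ g ∈ G, ∀ x y, A (g x) (g y) = A x y)
    {p : ℕ} (hp : p.Prime) (hdvd : p ∣ Nat.card G) :
    p = 2 ∨ p = 3 ∨ p = 5 ∨ p = 7 ∨ p = 11 ∨ p = 13 ∨ p = 23 ∨ p = 37 ∨ p = 41 ∨ p = 83 := by
  haveI := Fact.mk hp
  obtain ⟨g, hg⟩ := exists_prime_orderOf_dvd_card' p hdvd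
  have hg' : orderOf (g : Equiv.Perm V) = p := by rw [Subgroup.orderOf_coe, hg]
  have hgp : (g : Equiv.Perm V) ^ p = 1 := by rw [← hg']; exact pow_orderOf_eq_one _
  have hg1 : (g : Equiv.Perm V) ≠ 1 := by
    intro h
    rw [h, orderOf_one] at hg'
    exact hp.one_lt.ne hg'
  exact aut_prime_spectrum_refined hV A h01 hsymm hdiag hk hsrg hp (g : Equiv.Perm V) hgp hg1 (hG g g.2)

/-- **`13² ∤ |G|`** (Burnside count in a subgroup of order `169`). -/
theorem autGroup_card_not_dvd_13_sq (hV : Fintype.card V = 333) (A : Matrix V V ℤ)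
    (h01 : ∀ x y, A x y = 0 ∨ A x y = 1) (hsymm : ∀ x y, A y x = A x y) (hdiag : ∀ x, A x x = 0)
    (hk : ∀ x, ∑ y, A x y = 166) (hsrg : ∀ x y, ∑ z, A x z * A z y = 83 * (1 + (if x = y then 1 else 0)) - A x y)
    (G : Subgroup (Equiv.Perm V)) (hG : ∀ g ∈ G, ∀ x y, A (g x) (g y) = A x y) :
    ¬ 13 ^ 2 ∣ Nat.card G := by
  classical
  intro hdvd
  haveI : Fact (Nat.Prime 13) := ⟨by norm_num⟩
  obtain ⟨K, hK⟩ := Sylow.exists_subgroup_card_pow_prime 13 hdvd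
  haveI : Fintype K := Fintype.ofFinite K
  have hKc : Fintype.card K = 169 := by rw [← Nat.card_eq_fintype_card, hK]; norm_num
  have hsmul : ∀ (k : K) (y : V), k • y = ((k : G) : Equiv.Perm V) y := fun _ _ => rfl
  -- every non-identity element of K has 13th power 1 and fixes 21 points
  have hfix : ∀ k : K, k ≠ 1 → Fintype.card (fixedBy V k) = 21 := by
    intro k hk1
    set kperm : Equiv.Perm V := ((k : G) : Equiv.Perm V) with hkperm_def
    have hkA : ∀ a b, A (kperm a) (kperm b) = A a b := hG kperm (k : G).2
    have hord : orderOf kperm ∣ 13 ^ 2 := by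
      rw [hkperm_def, Subgroup.orderOf_coe, Subgroup.orderOf_coe, ← hK]
      exact orderOf_dvd_natCard k
    have h169 : kperm ^ 169 = 1 := by
      have := orderOf_dvd_iff_pow_eq_one.mp hord
      simpa using this
    have hne : kperm ≠ 1 := by
      intro e
      apply hk1
      have : ((k : G) : Equiv.Perm V) = ((1 : K) : G) := by rw [← hkperm_def, e]; rfl
      exact Subtype.ext (Subtype.ext this)
    have h13 : kperm ^ 13 = 1 := by
      by_contra h13
      exact no_aut_order_169 hV A h01 hsymm hdiag hk hsrg kperm h169 h13 hkA
    have hw := aut_order13_fixed hV A h01 hsymm hdiag hk hsrg kperm h13 hne hkA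
    rw [← hw, ← Set.toFinset_card]
    congr 1
    ext y
    rw [Set.mem_toFinset, Finset.mem_filter, MulAction.mem_fixedBy, hsmul]
    simp [hkperm_def]
  -- Burnside
  have hB := MulAction.sum_card_fixedBy_eq_card_orbits_mul_card_group K V
  rw [hKc] at hB
  have hsplit : ∑ g : K, Fintype.card (fixedBy V g) = 333 + 168 * 21 := by
    rw [← Finset.sum_erase_add _ _ (Finset.mem_univ (1 : K))]
    have h1 : Fintype.card (fixedBy V (1 : K)) = 333 := by
      rw [← hV, ← Set.toFinset_card]
      have : (fixedBy V (1 : K)).toFinset = univ := by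
        ext y; simp [MulAction.fixedBy_one_eq_univ]
      rw [this, Finset.card_univ]
    rw [h1, Finset.sum_congr rfl fun g hg => hfix g (Finset.ne_of_mem_erase hg), Finset.sum_const,
      Finset.card_erase_of_mem (Finset.mem_univ _), Finset.card_univ, hKc, smul_eq_mul]
  rw [hsplit] at hB
  omega

/-- **Shape of `|Aut|`.**  For every group `G` of automorphisms of an `srg(333,166,82,83)` and every prime `p ∣ |G|`:
`p ∈ {2,3,5,7,11,13,23,37,41,83}`, and `p² ∤ |G|` when `p ∈ {13, 23, 37, 41, 83}` — i.e. `|G|` divides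
`2^a 3^b 5^c 7^d 11^e · 13 · 23 · 37 · 41 · 83` for some exponents. -/
theorem autGroup_order_shape (hV : Fintype.card V = 333) (A : Matrix V V ℤ)
    (h01 : ∀ x y, A x y = 0 ∨ A x y = 1) (hsymm : ∀ x y, A y x = A x y) (hdiag : ∀ x, A x x = 0)
    (hk : ∀ x, ∑ y, A x y = 166) (hsrg : ∀ x y, ∑ z, A x z * A z y = 83 * (1 + (if x = y then 1 else 0)) - A x y)
    (G : Subgroup (Equiv.Perm V)) (hG : ∀ g ∈ G, ∀ x y, A (g x) (g y) = A x y) {p : ℕ} (hp : p.Prime)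
    (hdvd : p ∣ Nat.card G) :
    (p = 2 ∨ p = 3 ∨ p = 5 ∨ p = 7 ∨ p = 11 ∨ p = 13 ∨ p = 23 ∨ p = 37 ∨ p = 41 ∨ p = 83) ∧
      ((p = 13 ∨ p = 23 ∨ p = 37 ∨ p = 41 ∨ p = 83) → ¬ p ^ 2 ∣ Nat.card G) := by
  refine ⟨autGroup_prime_dvd_card_refined hV A h01 hsymm hdiag hk hsrg G hG hp hdvd, fun h5 => ?_⟩
  obtain ⟨h23, h37, h41, h83⟩ := autGroup_card_not_dvd_23_37_41_83_sq hV A h01 hsymm hdiag hk hsrg G hG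
  rcases h5 with rfl | rfl | rfl | rfl | rfl
  · exact autGroup_card_not_dvd_13_sq hV A h01 hsymm hdiag hk hsrg G hG
  · exact h23
  · exact h37
  · exact h41
  · exact h83

end orders

end Summit.Ventures.DiscreteObjects.Hadamard
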